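import Summits.ResolutionOfSingularities.ResolutionOfSingularities.Theorems.FrobeniusClosingSteerSwitchRecurrence
import Summits.ResolutionOfSingularities.ResolutionOfSingularities.Theorems.FrobeniusClosingSteerWords06SteeredVocab
import Summits.ResolutionOfSingularities.ResolutionOfSingularities.Theorems.FrobeniusClosingSteerWords12MemberDatum
import Literature.AlgebraicGeometry.Resolution.RsopMonomialIdeals

/-!
# Crux `Steer` (stmt-ResolutionOfSingularities-16345), chain W4.1, (Par-S) odd branch: the ARITH-REDUCTION hARᵒ
# `StrippingTailSwitchingOddArithTwoN`, STAGE 1 — the assembly with the geometric bricks as NAMED HYPOTHESES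
# (res-L0-w41-plan-1 RULINGS 121c/123b/124a; res-L0-w41-strat-2 §σ2.28 (g0)/(g2); res-L0-w41-tri-2 F1 (g′0)/(g′1); res-L0-w41-tri-1 A7;
# blueprint `L/res-type-062/hAR-BLUEPRINT.md` b05763b89178e0bc; Theses-free support)

OURS (campaign `res-hironaka`, rung L ★L-G4, slot W4.1; statements about the route's own objects — a σ_top-steered run `IsSteeredRun O R P t p s`
(`…Words06SteeredVocab`), its point steps / positive steps (`SigmaTopLegality.IsPointStep`, `.IsPosStep`), binary residue data; they replace the
role of no printed item and are NOT statements of the manuscript under review [claim: Hironaka2017, status: under-review]; AI review is weaker than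
expert review). Seat res-type-062 g15. No Theses file is imported; nothing here is a route item.

## The words (re-declared VERBATIM, character-identical bodies; the holder's leaf closes by defeq — plan-1 RULING 126c pattern)

`ArithBinaryResidueAt`, `ArithSwitchClause` = res-L0-w41-strat-2's (g0) (tri-1 A7 VERBATIM); `OddCleanedPointStepAt` = res-L0-w41-tri-2's (g′0).

## STAGE 1 (this file): hARᵒ's conclusion `ArithSwitchClause R P s p` ASSEMBLED from
* the run (`IsSteeredRun`, `R 0 = locAtCentre A₀ O`) and the (Par-S) NON-PERSISTENCE binder — via the landed brick (S4)
  `SwitchRecurrence.exists_switch_pair_beyond_of_not_persistent` (switch pairs beyond every stage);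
* «odd cleaned-order point steps infinitely often» (the (g′1) binder) — only to make point steps recur;
* LATENESS `hlate : ∀ j ≥ N, IsPosStep R P j → (P j).height < 2` — the unfolded content of `¬ HeightTwoStepsInfinite`
  (`exists_bound_of_not_infinite_posStepTwo` derives it);
* and THREE NAMED HYPOTHESES, the slots of the blueprint, to be discharged by STAGE 2 / the brick owners:
  (H1) a constant odd `d ≥ 3` (S1, D·S3/D·S4), (H2) «SWITCH ⇒ an A-stage in between with a BINARY degree-`d` cleaned tangent form in an rsop pair»
  (S2+S3: (R2)/(R4), res-type-096's `BinaryResidue.…cone_fourVar` cores p531760), (H3) «LEGALITY: a residue zero of the binary form at a late point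
  step forces a LATER positive step of height ≥ 2» (S5: (R1), res-D-pv-003 #2 + res-type-072 #3 cores).
`arithSwitchClause_of_bricks` is that glue; `arithSwitchClause_of_bricks_run` feeds (S4)'s inputs from the run words.
[cite: NovacoskiSpivakovsky2014, Def. 2.11] [cite: HeinzerEtAl2015, Remark 2.4] [folklore]
-/

-- `Summit.<S>.<S>.…` duplicates the summit name by design (single-problem summit).
set_option linter.dupNamespace false

open IsLocalRing
open Literature.AlgebraicGeometry.Resolution (IsLocalBlowupAlong SubringDominates IsRsopPart locAtCentre
  subringDominates_locAtCentre)

namespace Summit.ResolutionOfSingularities.ResolutionOfSingularities.Theorems.SwitchingDichotomy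

namespace ArithReduction

open Summit.ResolutionOfSingularities.ResolutionOfSingularities.Theorems.SwitchingDichotomy.SigmaTopLegality (IsPointStep IsPosStep)
open Summit.ResolutionOfSingularities.ResolutionOfSingularities.Theorems.SwitchingDichotomy.Words (IsSteeredRun)

variable {K : Type} [Field K]

/-! ## The words (VERBATIM) -/

/-- **(g0) · ArithBinaryResidueAt** (res-L0-w41-tri-1 v6.10 A7, VERBATIM from `v610/ArithWord.lean` 53185a2f9b17b242 = strat-2 §σ2.28 (g0)):
stage `i` is a POINT step with CLEANED tangent form binary of degree `d` — `s i ^ p − g² − Ψ(m₁, m₂) ∈ 𝔪^(d+1)` with `(m₁, m₂)` part of a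
r.s.o.p. and `Ψ` homogeneous of degree `d` — whose reduction `Ψ̄` over `κ_i` has NO zero on `κ_i² ∖ 0` (⟺ no `κ_i`-linear factor). OURS. [folklore] -/
def ArithBinaryResidueAt (R : ℕ → Subring K) (P : (i : ℕ) → Ideal (R i)) (s : ℕ → K) (p d i : ℕ) : Prop :=
  IsPointStep R P i ∧
    ∃ (_ : IsLocalRing (R i)) (hs : s i ^ p ∈ R i) (g m₁ m₂ : R i) (Ψ : MvPolynomial (Fin 2) (R i)),
      IsRsopPart ![m₁, m₂] ∧ Ψ.IsHomogeneous d ∧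
      (⟨s i ^ p, hs⟩ : R i) - g ^ 2 - MvPolynomial.eval ![m₁, m₂] Ψ ∈ maximalIdeal (R i) ^ (d + 1) ∧
      ∀ a b : ResidueField (R i), (a ≠ 0 ∨ b ≠ 0) →
        MvPolynomial.eval ![a, b] (MvPolynomial.map (residue (R i)) Ψ) ≠ 0

/-- **(g0) · ArithSwitchClause** (tri-1 A7, VERBATIM = strat-2 §σ2.28 (g0)): «arithmetic binary residue infinitely often» — one odd `d ≥ 3` and,
beyond every stage, a point step with an arithmetic binary residue of degree `d`. OURS. [folklore] -/
def ArithSwitchClause (R : ℕ → Subring K) (P : (i : ℕ) → Ideal (R i)) (s : ℕ → K) (p : ℕ) : Prop :=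
  ∃ d : ℕ, Odd d ∧ 3 ≤ d ∧ ∀ i₀ : ℕ, ∃ i, i₀ ≤ i ∧ ArithBinaryResidueAt R P s p d i

/-- **(g′0) · OddCleanedPointStepAt** (res-L0-w41-tri-2 F1, VERBATIM): stage `i` is a POINT step whose CLEANED order is an odd `d`:
`s i ^ p − g ^ p ∈ 𝔪 ^ d` for some `g` and `s i ^ p − h ^ p ∉ 𝔪 ^ (d+1)` for every `h`. OURS. [folklore] -/
def OddCleanedPointStepAt (R : ℕ → Subring K) (P : (i : ℕ) → Ideal (R i)) (s : ℕ → K) (p i : ℕ) : Prop :=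
  IsPointStep R P i ∧
    ∃ (_ : IsLocalRing (R i)) (hs : s i ^ p ∈ R i) (d : ℕ), Odd d ∧
      (∃ g : R i, (⟨s i ^ p, hs⟩ : R i) - g ^ p ∈ maximalIdeal (R i) ^ d) ∧
      ∀ h : R i, (⟨s i ^ p, hs⟩ : R i) - h ^ p ∉ maximalIdeal (R i) ^ (d + 1)

/-! ## Lateness: the unfolded content of `¬ HeightTwoStepsInfinite` -/

/-- If only finitely many positive steps have height `≥ 2` (the F-B binder `¬ HeightTwoStepsInfinite R P`, whose body is
`{j | IsPosStep R P j ∧ 2 ≤ (P j).height}.Infinite` up to the name `IsPosStepTwo`), then beyond some stage every positive step has height `< 2`.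
[folklore] -/
theorem exists_bound_of_not_infinite_posStepTwo {R : ℕ → Subring K} {P : (i : ℕ) → Ideal (R i)}
    (h : ¬ {j | IsPosStep R P j ∧ 2 ≤ (P j).height}.Infinite) :
    ∃ N : ℕ, ∀ j, N ≤ j → IsPosStep R P j → (P j).height < 2 := by
  have hfin : {j | IsPosStep R P j ∧ 2 ≤ (P j).height}.Finite := Set.not_infinite.mp h
  obtain ⟨N, hN⟩ := hfin.bddAbove
  refine ⟨N + 1, fun j hj hpos => ?_⟩
  by_contra hlt
  have hmem : j ∈ {j | IsPosStep R P j ∧ 2 ≤ (P j).height} := ⟨hpos, not_lt.mp hlt⟩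
  have := hN hmem
  omega

/-! ## STAGE 1: the assembly -/

section Assembly

variable {O : ValuationSubring K} {R : ℕ → Subring K} {P : (i : ℕ) → Ideal (R i)} {s : ℕ → K}

/-- **hARᵒ ASSEMBLED FROM THE BRICKS (tower form).** Along a tower of local blowing ups dominated by `O` with recurring point steps and the
(Par-S) NON-PERSISTENCE clause, given an odd `d ≥ 3`, a lateness bound `N`, and the two geometric slots
(H2) «a late switch pair `j < j'` has a point step `i`, `j ≤ i ≤ j'`, whose cleaned tangent form is BINARY of degree `d` in an rsop pair» and
(H3) «at a late point step, a residue zero of such a binary form forces a LATER positive step of height `≥ 2`»,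
the run carries arithmetic binary residues of degree `d` beyond every stage: `ArithSwitchClause R P s p`. [folklore] -/
theorem arithSwitchClause_of_bricks (p : ℕ) (hbl : ∀ i, IsLocalBlowupAlong O (R i) (P i) (R (i + 1)))
    (h0 : SubringDominates (R 0) O.toSubring) (hrec : ∀ i₀, ∃ i, i₀ ≤ i ∧ IsPointStep R P i)
    (hnp : ¬ ∃ i₀ : ℕ, ∃ x : K, x ≠ 0 ∧ x ∈ O ∧ O.valuation x < 1 ∧
      ∀ i, i₀ ≤ i → ∀ y ∈ R i, O.valuation y < 1 → ∃ j, i < j ∧ y / x ∈ R j)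
    {d : ℕ} (hd : Odd d) (h3 : 3 ≤ d) {N : ℕ}
    (hlate : ∀ j, N ≤ j → IsPosStep R P j → (P j).height < 2)
    (H2 : ∀ (j j' : ℕ) (x : K), N ≤ j → j < j' → IsPointStep R P j → IsPointStep R P j' →
      ((∃ hx : x ∈ R j, (⟨x, hx⟩ : R j) ∈ P j) ∧ x ≠ 0 ∧ ∀ y : R j, y ∈ P j → O.valuation (y : K) ≤ O.valuation x) →
      ¬ ((∃ hx : x ∈ R j', (⟨x, hx⟩ : R j') ∈ P j') ∧ ∀ y : R j', y ∈ P j' → O.valuation (y : K) ≤ O.valuation x) →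
      ∃ i, j ≤ i ∧ i ≤ j' ∧ IsPointStep R P i ∧
        ∃ (_ : IsLocalRing (R i)) (hs : s i ^ p ∈ R i) (g m₁ m₂ : R i) (Ψ : MvPolynomial (Fin 2) (R i)),
          IsRsopPart ![m₁, m₂] ∧ Ψ.IsHomogeneous d ∧
          (⟨s i ^ p, hs⟩ : R i) - g ^ 2 - MvPolynomial.eval ![m₁, m₂] Ψ ∈ maximalIdeal (R i) ^ (d + 1))
    (H3 : ∀ (i : ℕ), N ≤ i → IsPointStep R P i →
      ∀ (_ : IsLocalRing (R i)) (hs : s i ^ p ∈ R i) (g m₁ m₂ : R i) (Ψ : MvPolynomial (Fin 2) (R i)),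
        IsRsopPart ![m₁, m₂] → Ψ.IsHomogeneous d →
        (⟨s i ^ p, hs⟩ : R i) - g ^ 2 - MvPolynomial.eval ![m₁, m₂] Ψ ∈ maximalIdeal (R i) ^ (d + 1) →
        (∃ a b : ResidueField (R i), (a ≠ 0 ∨ b ≠ 0) ∧
          MvPolynomial.eval ![a, b] (MvPolynomial.map (residue (R i)) Ψ) = 0) →
        ∃ j', i < j' ∧ IsPosStep R P j' ∧ 2 ≤ (P j').height) :
    ArithSwitchClause R P s p := by
  refine ⟨d, hd, h3, fun i₀ => ?_⟩
  -- a late switch pair beyond `max i₀ N`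
  obtain ⟨j, j', x, hj, hjj', hpt, hpt', hx, hnot⟩ :=
    SwitchRecurrence.exists_switch_pair_beyond_of_not_persistent hbl h0 hrec hnp (max i₀ N)
  have hjN : N ≤ j := (le_max_right _ _).trans hj
  have hji₀ : i₀ ≤ j := (le_max_left _ _).trans hj
  -- (H2): a binary A-stage between `j` and `j'`
  obtain ⟨i, hji, -, hpti, hloc, hs, g, m₁, m₂, Ψ, hrsop, hhom, hcong⟩ := H2 j j' x hjN hjj' hpt hpt' hx hnot
  refine ⟨i, hji₀.trans hji, hpti, hloc, hs, g, m₁, m₂, Ψ, hrsop, hhom, hcong, ?_⟩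
  -- (H3): rootless by lateness
  intro a b hab hzero
  obtain ⟨j'', hij'', hpos, hht⟩ := H3 i (hjN.trans hji) hpti hloc hs g m₁ m₂ Ψ hrsop hhom hcong ⟨a, b, hab, hzero⟩
  have hlt := hlate j'' ((hjN.trans hji).trans hij''.le) hpos
  exact absurd hht (not_le.mpr hlt)

/-- **hARᵒ ASSEMBLED FROM THE BRICKS (run form)** — the inputs of (S4) read off the run words: `IsSteeredRun O R P t p s` gives the blow-up
clauses, `R 0 = locAtCentre A₀ O` the domination of `R 0`, and «odd cleaned-order point steps i.o.» (the (g′1) binder) the recurrence of point steps.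
The holder's leaf for `StrippingTailSwitchingOddArithTwoN` is `intro …` + this theorem with (H1)–(H3) supplied by STAGE 2. [folklore] -/
theorem arithSwitchClause_of_bricks_run {k : Type} [Field k] [Algebra k K] (A₀ : Subalgebra k K)
    (h₀ : A₀.toSubring ≤ O.toSubring) {t : K} (p : ℕ) (hR0 : R 0 = locAtCentre A₀.toSubring O)
    (hrun : IsSteeredRun O R P t p s)
    (hnp : ¬ ∃ i₀ : ℕ, ∃ x : K, x ≠ 0 ∧ x ∈ O ∧ O.valuation x < 1 ∧
      ∀ i, i₀ ≤ i → ∀ y ∈ R i, O.valuation y < 1 → ∃ j, i < j ∧ y / x ∈ R j)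
    (hodd : ∀ i₀ : ℕ, ∃ i, i₀ ≤ i ∧ OddCleanedPointStepAt R P s p i)
    {d : ℕ} (hd : Odd d) (h3 : 3 ≤ d) {N : ℕ}
    (hlate : ∀ j, N ≤ j → IsPosStep R P j → (P j).height < 2)
    (H2 : ∀ (j j' : ℕ) (x : K), N ≤ j → j < j' → IsPointStep R P j → IsPointStep R P j' →
      ((∃ hx : x ∈ R j, (⟨x, hx⟩ : R j) ∈ P j) ∧ x ≠ 0 ∧ ∀ y : R j, y ∈ P j → O.valuation (y : K) ≤ O.valuation x) →
      ¬ ((∃ hx : x ∈ R j', (⟨x, hx⟩ : R j') ∈ P j') ∧ ∀ y : R j', y ∈ P j' → O.valuation (y : K) ≤ O.valuation x) →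
      ∃ i, j ≤ i ∧ i ≤ j' ∧ IsPointStep R P i ∧
        ∃ (_ : IsLocalRing (R i)) (hs : s i ^ p ∈ R i) (g m₁ m₂ : R i) (Ψ : MvPolynomial (Fin 2) (R i)),
          IsRsopPart ![m₁, m₂] ∧ Ψ.IsHomogeneous d ∧
          (⟨s i ^ p, hs⟩ : R i) - g ^ 2 - MvPolynomial.eval ![m₁, m₂] Ψ ∈ maximalIdeal (R i) ^ (d + 1))
    (H3 : ∀ (i : ℕ), N ≤ i → IsPointStep R P i →
      ∀ (_ : IsLocalRing (R i)) (hs : s i ^ p ∈ R i) (g m₁ m₂ : R i) (Ψ : MvPolynomial (Fin 2) (R i)),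
        IsRsopPart ![m₁, m₂] → Ψ.IsHomogeneous d →
        (⟨s i ^ p, hs⟩ : R i) - g ^ 2 - MvPolynomial.eval ![m₁, m₂] Ψ ∈ maximalIdeal (R i) ^ (d + 1) →
        (∃ a b : ResidueField (R i), (a ≠ 0 ∨ b ≠ 0) ∧
          MvPolynomial.eval ![a, b] (MvPolynomial.map (residue (R i)) Ψ) = 0) →
        ∃ j', i < j' ∧ IsPosStep R P j' ∧ 2 ≤ (P j').height) :
    ArithSwitchClause R P s p := by
  have hbl : ∀ i, IsLocalBlowupAlong O (R i) (P i) (R (i + 1)) := fun i => by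
    obtain ⟨_, _, -, h, -⟩ := hrun.2 i
    exact h
  have hdom0 : SubringDominates (R 0) O.toSubring := by
    rw [hR0]
    exact subringDominates_locAtCentre h₀
  have hrec : ∀ i₀, ∃ i, i₀ ≤ i ∧ IsPointStep R P i := fun i₀ => by
    obtain ⟨i, hi, hpt, -⟩ := hodd i₀
    exact ⟨i, hi, hpt⟩
  exact arithSwitchClause_of_bricks p hbl hdom0 hrec hnp hd h3 hlate H2 H3

end Assembly

/-! ## STAGE 1 v2 (res-L0-w41-plan-1 RULINGS 132a/137a; res-L0-w41-tri-1 WORDS 12 `…Words12MemberDatum` p535085): slot H1 re-cut to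
`EventuallyConstantReducedOrder` and the ON-AXIS clause threaded from H2 to H3 (res-D-pv-003 #2 part 3 `exists_isPermissibleCentre_of_residue_zero`
consumes `v m₁ < v u ∧ v m₂ < v u` for an exceptional parameter `u` of the A-stage) -/

section AssemblyV2

variable {O : ValuationSubring K} {R : ℕ → Subring K} {P : (i : ℕ) → Ideal (R i)} {s : ℕ → K}

open Summit.ResolutionOfSingularities.ResolutionOfSingularities.Theorems.SwitchingDichotomy.Words
  (HasReducedOrderAt IsAStageAt EventuallyConstantReducedOrder)

/-- **hARᵒ ASSEMBLED FROM THE BRICKS, ON-AXIS form.** As `arithSwitchClause_of_bricks`, but (H2ₐ) also outputs an exceptional parameter `u` of the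
A-stage `i` with the rsop pair ON ITS AXIS (`v m₁ < v u`, `v m₂ < v u`: the next centre lies on `{m̄₁ = m̄₂ = 0}`), and (H3ₐ) consumes that clause —
the shape res-D-pv-003's `OddBranchParity.exists_isPermissibleCentre_of_residue_zero` needs. [folklore] -/
theorem arithSwitchClause_of_bricks_onAxis (p : ℕ) (hbl : ∀ i, IsLocalBlowupAlong O (R i) (P i) (R (i + 1)))
    (h0 : SubringDominates (R 0) O.toSubring) (hrec : ∀ i₀, ∃ i, i₀ ≤ i ∧ IsPointStep R P i)
    (hnp : ¬ ∃ i₀ : ℕ, ∃ x : K, x ≠ 0 ∧ x ∈ O ∧ O.valuation x < 1 ∧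
      ∀ i, i₀ ≤ i → ∀ y ∈ R i, O.valuation y < 1 → ∃ j, i < j ∧ y / x ∈ R j)
    {d : ℕ} (hd : Odd d) (h3 : 3 ≤ d) {N : ℕ}
    (hlate : ∀ j, N ≤ j → IsPosStep R P j → (P j).height < 2)
    (H2 : ∀ (j j' : ℕ) (x : K), N ≤ j → j < j' → IsPointStep R P j → IsPointStep R P j' →
      ((∃ hx : x ∈ R j, (⟨x, hx⟩ : R j) ∈ P j) ∧ x ≠ 0 ∧ ∀ y : R j, y ∈ P j → O.valuation (y : K) ≤ O.valuation x) →
      ¬ ((∃ hx : x ∈ R j', (⟨x, hx⟩ : R j') ∈ P j') ∧ ∀ y : R j', y ∈ P j' → O.valuation (y : K) ≤ O.valuation x) →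
      ∃ i, j ≤ i ∧ i ≤ j' ∧ IsPointStep R P i ∧
        ∃ (_ : IsLocalRing (R i)) (hs : s i ^ p ∈ R i) (g m₁ m₂ : R i) (Ψ : MvPolynomial (Fin 2) (R i)) (u : K),
          IsRsopPart ![m₁, m₂] ∧ Ψ.IsHomogeneous d ∧
          (⟨s i ^ p, hs⟩ : R i) - g ^ 2 - MvPolynomial.eval ![m₁, m₂] Ψ ∈ maximalIdeal (R i) ^ (d + 1) ∧
          ((∃ hu : u ∈ R i, (⟨u, hu⟩ : R i) ∈ P i) ∧ u ≠ 0 ∧ ∀ y : R i, y ∈ P i → O.valuation (y : K) ≤ O.valuation u) ∧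
          O.valuation (m₁ : K) < O.valuation u ∧ O.valuation (m₂ : K) < O.valuation u)
    (H3 : ∀ (i : ℕ), N ≤ i → IsPointStep R P i →
      ∀ (_ : IsLocalRing (R i)) (hs : s i ^ p ∈ R i) (g m₁ m₂ : R i) (Ψ : MvPolynomial (Fin 2) (R i)) (u : K),
        IsRsopPart ![m₁, m₂] → Ψ.IsHomogeneous d →
        (⟨s i ^ p, hs⟩ : R i) - g ^ 2 - MvPolynomial.eval ![m₁, m₂] Ψ ∈ maximalIdeal (R i) ^ (d + 1) →
        ((∃ hu : u ∈ R i, (⟨u, hu⟩ : R i) ∈ P i) ∧ u ≠ 0 ∧ ∀ y : R i, y ∈ P i → O.valuation (y : K) ≤ O.valuation u) →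
        O.valuation (m₁ : K) < O.valuation u → O.valuation (m₂ : K) < O.valuation u →
        (∃ a b : ResidueField (R i), (a ≠ 0 ∨ b ≠ 0) ∧
          MvPolynomial.eval ![a, b] (MvPolynomial.map (residue (R i)) Ψ) = 0) →
        ∃ j', i < j' ∧ IsPosStep R P j' ∧ 2 ≤ (P j').height) :
    ArithSwitchClause R P s p := by
  refine ⟨d, hd, h3, fun i₀ => ?_⟩
  obtain ⟨j, j', x, hj, hjj', hpt, hpt', hx, hnot⟩ :=
    SwitchRecurrence.exists_switch_pair_beyond_of_not_persistent hbl h0 hrec hnp (max i₀ N)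
  have hjN : N ≤ j := (le_max_right _ _).trans hj
  have hji₀ : i₀ ≤ j := (le_max_left _ _).trans hj
  obtain ⟨i, hji, -, hpti, hloc, hs, g, m₁, m₂, Ψ, u, hrsop, hhom, hcong, hu, hm₁, hm₂⟩ :=
    H2 j j' x hjN hjj' hpt hpt' hx hnot
  refine ⟨i, hji₀.trans hji, hpti, hloc, hs, g, m₁, m₂, Ψ, hrsop, hhom, hcong, ?_⟩
  intro a b hab hzero
  obtain ⟨j'', hij'', hpos, hht⟩ :=
    H3 i (hjN.trans hji) hpti hloc hs g m₁ m₂ Ψ u hrsop hhom hcong hu hm₁ hm₂ ⟨a, b, hab, hzero⟩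
  have hlt := hlate j'' ((hjN.trans hji).trans hij''.le) hpos
  exact absurd hht (not_le.mpr hlt)

/-- **hARᵒ ASSEMBLED, slot H1 in res-L0-w41-tri-1's MEMBER-DATUM currency** (`…Words12MemberDatum`): the odd `d ≥ 3`, the reduced-order constancy
from some point step `i₁` on, and the recurrence of A-stages are `Words.EventuallyConstantReducedOrder R P s p` (S1b, res-type-096's target);
(H2ₘ) may use the constancy facts (it receives `d`, `i₁` and both clauses); (H3ₘ) is (H3ₐ) for that `d`. [folklore] -/
theorem arithSwitchClause_of_memberDatum (p : ℕ) (hbl : ∀ i, IsLocalBlowupAlong O (R i) (P i) (R (i + 1)))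
    (h0 : SubringDominates (R 0) O.toSubring)
    (hnp : ¬ ∃ i₀ : ℕ, ∃ x : K, x ≠ 0 ∧ x ∈ O ∧ O.valuation x < 1 ∧
      ∀ i, i₀ ≤ i → ∀ y ∈ R i, O.valuation y < 1 → ∃ j, i < j ∧ y / x ∈ R j)
    (hS1b : EventuallyConstantReducedOrder R P s p) {N : ℕ}
    (hlate : ∀ j, N ≤ j → IsPosStep R P j → (P j).height < 2)
    (H2 : ∀ (d i₁ : ℕ), Odd d → 3 ≤ d → (∀ i, i₁ ≤ i → IsPointStep R P i → HasReducedOrderAt R s p i d) →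
      (∀ i₀, ∃ i, i₀ ≤ i ∧ IsAStageAt R P s p i d) →
      ∀ (j j' : ℕ) (x : K), max N i₁ ≤ j → j < j' → IsPointStep R P j → IsPointStep R P j' →
      ((∃ hx : x ∈ R j, (⟨x, hx⟩ : R j) ∈ P j) ∧ x ≠ 0 ∧ ∀ y : R j, y ∈ P j → O.valuation (y : K) ≤ O.valuation x) →
      ¬ ((∃ hx : x ∈ R j', (⟨x, hx⟩ : R j') ∈ P j') ∧ ∀ y : R j', y ∈ P j' → O.valuation (y : K) ≤ O.valuation x) →
      ∃ i, j ≤ i ∧ i ≤ j' ∧ IsPointStep R P i ∧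
        ∃ (_ : IsLocalRing (R i)) (hs : s i ^ p ∈ R i) (g m₁ m₂ : R i) (Ψ : MvPolynomial (Fin 2) (R i)) (u : K),
          IsRsopPart ![m₁, m₂] ∧ Ψ.IsHomogeneous d ∧
          (⟨s i ^ p, hs⟩ : R i) - g ^ 2 - MvPolynomial.eval ![m₁, m₂] Ψ ∈ maximalIdeal (R i) ^ (d + 1) ∧
          ((∃ hu : u ∈ R i, (⟨u, hu⟩ : R i) ∈ P i) ∧ u ≠ 0 ∧ ∀ y : R i, y ∈ P i → O.valuation (y : K) ≤ O.valuation u) ∧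
          O.valuation (m₁ : K) < O.valuation u ∧ O.valuation (m₂ : K) < O.valuation u)
    (H3 : ∀ (d : ℕ), Odd d → 3 ≤ d → ∀ (i : ℕ), N ≤ i → IsPointStep R P i →
      ∀ (_ : IsLocalRing (R i)) (hs : s i ^ p ∈ R i) (g m₁ m₂ : R i) (Ψ : MvPolynomial (Fin 2) (R i)) (u : K),
        IsRsopPart ![m₁, m₂] → Ψ.IsHomogeneous d →
        (⟨s i ^ p, hs⟩ : R i) - g ^ 2 - MvPolynomial.eval ![m₁, m₂] Ψ ∈ maximalIdeal (R i) ^ (d + 1) →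
        ((∃ hu : u ∈ R i, (⟨u, hu⟩ : R i) ∈ P i) ∧ u ≠ 0 ∧ ∀ y : R i, y ∈ P i → O.valuation (y : K) ≤ O.valuation u) →
        O.valuation (m₁ : K) < O.valuation u → O.valuation (m₂ : K) < O.valuation u →
        (∃ a b : ResidueField (R i), (a ≠ 0 ∨ b ≠ 0) ∧
          MvPolynomial.eval ![a, b] (MvPolynomial.map (residue (R i)) Ψ) = 0) →
        ∃ j', i < j' ∧ IsPosStep R P j' ∧ 2 ≤ (P j').height) :
    ArithSwitchClause R P s p := by
  obtain ⟨d, i₁, hd, h3, hred, hA⟩ := hS1b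
  have hrec : ∀ i₀, ∃ i, i₀ ≤ i ∧ IsPointStep R P i := fun i₀ => by
    obtain ⟨i, hi, hAi⟩ := hA i₀
    exact ⟨i, hi, hAi.1⟩
  refine arithSwitchClause_of_bricks_onAxis p hbl h0 hrec hnp hd h3 (N := max N i₁)
    (fun j hj hpos => hlate j ((le_max_left _ _).trans hj) hpos) (H2 d i₁ hd h3 hred hA) ?_
  intro i hi hpti hloc hs g m₁ m₂ Ψ u hrsop hhom hcong hu hm₁ hm₂ hzero
  exact H3 d hd h3 i ((le_max_left _ _).trans hi) hpti hloc hs g m₁ m₂ Ψ u hrsop hhom hcong hu hm₁ hm₂ hzero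

/-- **hARᵒ ASSEMBLED, run form in the member-datum currency** — inputs read off the run words exactly as in
`arithSwitchClause_of_bricks_run`; the holder's leaf for `StrippingTailSwitchingOddArithTwoN` is `intro …` + this theorem once
(S1b) `EventuallyConstantReducedOrder` (res-type-096, from the (g′1) binder «odd cleaned-order point steps i.o.» + the run), (H2ₘ) and (H3ₘ) are
theorems. [folklore] -/
theorem arithSwitchClause_of_memberDatum_run {k : Type} [Field k] [Algebra k K] (A₀ : Subalgebra k K)
    (h₀ : A₀.toSubring ≤ O.toSubring) {t : K} (p : ℕ) (hR0 : R 0 = locAtCentre A₀.toSubring O)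
    (hrun : IsSteeredRun O R P t p s)
    (hnp : ¬ ∃ i₀ : ℕ, ∃ x : K, x ≠ 0 ∧ x ∈ O ∧ O.valuation x < 1 ∧
      ∀ i, i₀ ≤ i → ∀ y ∈ R i, O.valuation y < 1 → ∃ j, i < j ∧ y / x ∈ R j)
    (hS1b : EventuallyConstantReducedOrder R P s p) {N : ℕ}
    (hlate : ∀ j, N ≤ j → IsPosStep R P j → (P j).height < 2)
    (H2 : ∀ (d i₁ : ℕ), Odd d → 3 ≤ d → (∀ i, i₁ ≤ i → IsPointStep R P i → HasReducedOrderAt R s p i d) →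
      (∀ i₀, ∃ i, i₀ ≤ i ∧ IsAStageAt R P s p i d) →
      ∀ (j j' : ℕ) (x : K), max N i₁ ≤ j → j < j' → IsPointStep R P j → IsPointStep R P j' →
      ((∃ hx : x ∈ R j, (⟨x, hx⟩ : R j) ∈ P j) ∧ x ≠ 0 ∧ ∀ y : R j, y ∈ P j → O.valuation (y : K) ≤ O.valuation x) →
      ¬ ((∃ hx : x ∈ R j', (⟨x, hx⟩ : R j') ∈ P j') ∧ ∀ y : R j', y ∈ P j' → O.valuation (y : K) ≤ O.valuation x) →
      ∃ i, j ≤ i ∧ i ≤ j' ∧ IsPointStep R P i ∧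
        ∃ (_ : IsLocalRing (R i)) (hs : s i ^ p ∈ R i) (g m₁ m₂ : R i) (Ψ : MvPolynomial (Fin 2) (R i)) (u : K),
          IsRsopPart ![m₁, m₂] ∧ Ψ.IsHomogeneous d ∧
          (⟨s i ^ p, hs⟩ : R i) - g ^ 2 - MvPolynomial.eval ![m₁, m₂] Ψ ∈ maximalIdeal (R i) ^ (d + 1) ∧
          ((∃ hu : u ∈ R i, (⟨u, hu⟩ : R i) ∈ P i) ∧ u ≠ 0 ∧ ∀ y : R i, y ∈ P i → O.valuation (y : K) ≤ O.valuation u) ∧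
          O.valuation (m₁ : K) < O.valuation u ∧ O.valuation (m₂ : K) < O.valuation u)
    (H3 : ∀ (d : ℕ), Odd d → 3 ≤ d → ∀ (i : ℕ), N ≤ i → IsPointStep R P i →
      ∀ (_ : IsLocalRing (R i)) (hs : s i ^ p ∈ R i) (g m₁ m₂ : R i) (Ψ : MvPolynomial (Fin 2) (R i)) (u : K),
        IsRsopPart ![m₁, m₂] → Ψ.IsHomogeneous d →
        (⟨s i ^ p, hs⟩ : R i) - g ^ 2 - MvPolynomial.eval ![m₁, m₂] Ψ ∈ maximalIdeal (R i) ^ (d + 1) →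
        ((∃ hu : u ∈ R i, (⟨u, hu⟩ : R i) ∈ P i) ∧ u ≠ 0 ∧ ∀ y : R i, y ∈ P i → O.valuation (y : K) ≤ O.valuation u) →
        O.valuation (m₁ : K) < O.valuation u → O.valuation (m₂ : K) < O.valuation u →
        (∃ a b : ResidueField (R i), (a ≠ 0 ∨ b ≠ 0) ∧
          MvPolynomial.eval ![a, b] (MvPolynomial.map (residue (R i)) Ψ) = 0) →
        ∃ j', i < j' ∧ IsPosStep R P j' ∧ 2 ≤ (P j').height) :
    ArithSwitchClause R P s p := by
  have hbl : ∀ i, IsLocalBlowupAlong O (R i) (P i) (R (i + 1)) := fun i => by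
    obtain ⟨_, _, -, h, -⟩ := hrun.2 i
    exact h
  have hdom0 : SubringDominates (R 0) O.toSubring := by
    rw [hR0]
    exact subringDominates_locAtCentre h₀
  exact arithSwitchClause_of_memberDatum p hbl hdom0 hnp hS1b hlate H2 H3

end AssemblyV2

end ArithReduction

end Summit.ResolutionOfSingularities.ResolutionOfSingularities.Theorems.SwitchingDichotomy
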